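import Mathlib
import HarnessLib
import HarnessLib.Audit
import Summits.AtomisticToContinuum.Statement
import Summits.AtomisticToContinuum.HydrodynamicLimit.Theorems.ImplosionDichotomyHsEosLowDensity
import HarnessLib.Audit.Status.Attr

/-!
Route: LoschmidtIsentropicSelection

DORMANT since 2026-08-23T19:08:35Z (reconciler: no traction for 6.2 d (last activity item-evidence-added at 2026-08-17T14:22:40Z); parked, not closed — `ledger route dormant route-AtomisticToContinuum-LoschmidtIsentropicSelection --off`) — unstaffed, not closed; items shared with open routes are served there. `ledger route dormant <id> --off` reactivates.

# Route LoschmidtIsentropicSelection — Loschmidt run forward — EOS-agnostic autonomous Euler closure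
+ free second law + one hydrostatic rung select hard-sphere Euler

It suffices to show X = X_A ∧ X_S ∧ X_H (card loschmidt-forward-autonomy-rigidity run forward;
conforming re-open of the retired route LoschmidtAutonomyRigidity, whose only defect was an assembly
concluding the Literature constant instead of the sub-problem Statement). X_A = AutonomousClosure
(EOS-AGNOSTIC AUTONOMY): below a packing threshold η₀ the empirical fields of local-Gibbs
hard-sphere data follow, in probability, the classical solution of a compressible Euler system
∂ₜρ+div(ρu)=0, ∂ₜ(ρu)+div(ρu⊗u)+∇p̃=0, ∂ₜE+div((E+p̃)u)=0, E = ρ(|u|²/2+3θ/2), for SOME smooth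
locally well-posed pressure law p̃_σ(ρ,θ) — nothing microscopic is identified. X_S = LimitSecondLaw
(FREE SECOND LAW): whenever such data have deterministic profile V at time 0 and Q at time t ≥ 0,
the total hard-sphere entropy ∫ρ(3/2 log θ − log ρ − f_ex(ρσ³)) of Q is ≥ that of V (Liouville
invariance of the global Gibbs law + static large deviations; De Roeck–Maes–Netočný run forward).
X_H = HydrostaticRung: rest local-Gibbs states isobaric for hsPressure stay macroscopically static.
Then IsentropicSelection (PDE calculus, provable now): the second law applied to data (ρ,u,θ) AND to
the Loschmidt-reflected data (ρ,−u,θ) forces equality — the macrodynamics is isentropic for the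
hard-sphere entropy — whence p̃ = ρθZ(ρσ³) − cθ, and the rung pins c = 0; so the closure IS
hs-Euler and RigidityBridge delivers the packing-guarded conjunct HydroLimitInBand (shared target),
which since the statement re-type of 2026-08-16 (p126922: `∃ η₀ > 0` outermost, conclusion only for
classical solutions with ρ_t(x)σ³ < η₀ on [0,T) × 𝕋³) IS the sub-problem Statement
`_root_.HydrodynamicLimit` VERBATIM — the guard of the Statement is exactly the guard under which
every item of this route was already stated, so no guard-removal input is needed any more
(DiluteSelfConsistency dropped 2026-08-16) and the deciding theorem `closes` is the bridge crux
RigidityBridge applied to the five other cruxes (definitional unfolding; certified crux-only,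
sorry-free; the proved EOS item HsEosLowDensity is consumed inside the bridge's proof).
Lean: `AutonomousClosure ∧ LimitSecondLaw ∧ HydrostaticRung`

## Assembly
Pure logic, certified crux-only (obligation-graph LAYER INVARIANT (ii)): `theorem closes (hA :
AutonomousClosure) (hS : LimitSecondLaw) (hH : HydrostaticRung) (hI : IsentropicSelection) (hR :
LocalGibbsRealisability) (hB : RigidityBridge) : _root_.HydrodynamicLimit := hB hA hS hH hI hR`
(glue.lean; gate render lean check rc 0, 0 sorries, closes ok): every hypothesis is a CRUX item —
the three physical cruxes, the constitutive-rigidity crux IsentropicSelection, the statics crux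
LocalGibbsRealisability and the bridge crux RigidityBridge (the last three re-kinded support → crux
on 2026-08-16 because the deciding theorem may assume cruxes and nothing else; the proved EOS item
HsEosLowDensity is consumed inside the proof of RigidityBridge, whose restated form no longer lists
it as an antecedent). The bridge yields HydroLimitInBand, whose body is verbatim the re-typed
Statement (packing threshold η₀ outermost, σ₀ per profile, guard ρσ³ < η₀ along the solution), so
the term elaborates by unfolding the two defs. Before the re-type `closes` also took (hD :
DiluteSelfConsistency) to strip the guard from the then-unguarded conjunct; that hypothesis is gone
with the item. The Assembly item below is the thesis-to-Statement implication as one Prop —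
AutonomousClosure → LimitSecondLaw → HydrostaticRung → IsentropicSelection → LocalGibbsRealisability
→ HydrodynamicLimit (the content of RigidityBridge concluded at the root name; either closes the
other by one line).

Rationale: WHY THIS LINE. Spohn1991 (Part I §3.1, PDF p. 40): the hydrodynamic description is complete
"provided the local
equilibrium parameters are governed by an autonomous evolution equation"; every other route on the
board identifies microscopic CURRENTS (virial theorem (3.15), relative entropy, cumulant/flux LD,
Young measures). This line asks only for AUTONOMY WITH EULER FORM and an unknown constitutive
pressure, and lets thermodynamics select the closure: RoeckMaesNetocny2006 §2–3 (autonomy ⇒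
H-theorem; exact autonomy ⇒ H constant, printed as a no-go) run FORWARD gives a free second law for
any deterministic limit from Liouville invariance plus Georgii-type static large deviations
(GeorgiiZessin1993, Georgii1994, KipnisLandim1999 entropy inequality), and the Coleman–Noll entropy
principle (ColemanNoll1963; perfect-fluid constitutive theory Serrin1959, TruesdellNoll2004) run
with EQUALITY — the entropy production ∫(p_hs−p̃)θ⁻¹div u is odd in u, Loschmidt's reversal at the
PDE level — leaves exactly the one-parameter family p̃ = p_hs − cθ (for which s − c/ρ is materially
conserved and ∫ρ s is exactly conserved, so every entropy / reversibility / Galilean / cubic /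
velocity-scaling input is blind to c); one static number is genuinely needed and the hydrostatic
rung (the virial theorem in macroscopic clothing) pins c = 0. Imported areas: rational
thermodynamics (constitutive rigidity), large deviations for Gibbs point fields,
symmetric-hyperbolic PDE (Majda1984, Kato1975). What gen-2 adds: a conforming deciding theorem, the
corrected blindness computation, and two foreseen replacement pins (initial-slope virial rung;
vacuum-corner kinematic rung) should HydrostaticRung stall. Negatives index: nothing refuted is
re-asked (the five refutations on this conjunct concern Enskog test families and warm/cold cell
dichotomies).

RANKED CRUXES. #0 HydroLimitInBand (target) — the packing-guarded conjunct (shared item, = stmt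
9133/3093 verbatim; since the statement re-type of 2026-08-16, p126922, it is LITERALLY the
sub-problem Statement `_root_.HydrodynamicLimit`, same body): ∃ η₀ > 0 such that for all continuous
positive profiles ∃ σ₀ ∀ σ ∈ (0,σ₀), for every classical hard-sphere Euler solution on [0,T) with
ρσ³ < η₀ on [0,T)×𝕋³ and every flow family, LLN of the three fields at t = 0 ⇒ LLN at every t < T.
(why it might fail: it is the conjunct minus the implosion loophole: a hidden slow field, anomalous
transport at Euler scale, or failure of propagation of local equilibrium for deterministic hard
spheres would refute it.) [Spohn1991, OllaVaradhanYau1993]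
#2 AutonomousClosure (crux) — (card item A with the Euler FORM folded in; EOS-agnostic) ∃ η₀ > 0 ∀ σ
> 0 ∃ a pressure law p̃(ρ,θ), C^∞ on {ρ > 0, ρσ³ < η₀, θ > 0}, such that (WP) Euler[p̃] with E =
ρ(|u|²/2+3θ/2) has a classical solution on some [0,T), T > 0, from every smooth positive datum with
packing < η₀, and (CONV) for all continuous positive local-Gibbs profiles (a₀,u₀,θ₀), every
classical Euler[p̃] solution on [0,T) with packing < η₀ and every flow family whose laws are
probability measures: LLN of the three fields at t = 0 ⇒ LLN at every t < T. The classical-solution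
predicate for a general pressure law is bound once inside the Prop (`∀ IsSol, (∀ p T ρ u θ, IsSol p
T ρ u θ ↔ ⟨the eight clauses of IsHardSphereEulerSolution with hsPressure σ replaced by p⟩) → …`).
[difficulty: open-problem] (why it might fail: A hidden slow extensive field (ideal-gas h(v),
hard-rod type) or surviving dependence on the velocity SHAPE of the data leaves no closed (ρ,u,θ)
system; the energy field needs σ-uniform velocity-tail control (HighMomentumCutoff); with p̃ :=
hsPressure it is the guarded conjunct itself.) [Spohn1991, RoeckMaesNetocny2006,
OllaVaradhanYau1993, Serrin1959]
#3 LimitSecondLaw (crux) — (card (P3), the free second law for deterministic limits) ∃ η₀ > 0 ∀ σ >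
0, for continuous positive local-Gibbs profiles (a₀,u₀,θ₀) under the activity guard a₀σ³ < η₀∫a₀,
all continuous positive profiles V = (ρ_V,u_V,θ_V), Q = (ρ_Q,u_Q,θ_Q) with packing < η₀, every flow
family with the laws probability measures and every t ≥ 0: fields → V in probability at time 0 and →
Q at time t ⇒ ∫ρ_V(3/2 log θ_V − log ρ_V − f_ex(ρ_Vσ³)) ≤ ∫ρ_Q(3/2 log θ_Q − log ρ_Q − f_ex(ρ_Qσ³))
(f_ex = hsExcessFreeEnergy). Mechanism: H(LG|G_N,β)/(N+1) → I_β(V), G_N invariant under every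
HardSphereFlow (Liouville + configEnergy_eq_holds), static LD upper bound G_N(fields ≈ Q) ≤ e^(−N
I_β(Q)+o(N)), entropy inequality P(A) ≤ (H+log 2)/log(1+1/G(A)); I_β = βE − S_hs + const and E(Q) =
E(V) exactly (χ ≡ 1, energy conservation). [difficulty: L] (why it might fail: Needs the static LD
principle and H(LG|G_N)/N → I(V) for the CANONICAL hard-sphere law on 𝕋³ with Maxwellian marks,
uniformly at packing < η₀ (GeorgiiZessin1993/Georgii1994 are grand-canonical, infinite volume);
exponential tightness of the kinetic-energy field is also used.) [RoeckMaesNetocny2006,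
GeorgiiZessin1993, Georgii1994, KipnisLandim1999, Ruelle1969]
#4 HydrostaticRung (crux) — (pins the pressure LEVEL c; the virial theorem in macroscopic clothing)
∃ η₀ > 0 ∀ σ > 0, for continuous positive activity a₀ with a₀σ³ < η₀∫a₀, smooth positive θ₀, ρ₀ with
ρ₀σ³ < η₀ and hsPressure σ ρ₀ θ₀ ≡ const on 𝕋³, and every flow family with the rest local Gibbs laws
localGibbsLaw σ a₀ 0 θ₀ probability measures: if the fields at time 0 converge in probability to
(ρ₀, 0, ρ₀·3θ₀/2) then they converge to the same static profile at every fixed t ≥ 0 (N → ∞ first).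
[difficulty: L] (why it might fail: σ-uniform, all fixed t ≥ 0: an O(1) anomalous heat/momentum
current in an isobaric rest state over N^(1/3) collision times, a linear-in-t drift from the initial
layer, or local-Gibbs contact pressure ≠ ρθZ(ρσ³) (virial theorem) would break it.) [Spohn1991,
LebowitzPenrose1964, Ruelle1969]
#9 IsentropicSelection (crux, rank 9 = after the three physical cruxes; re-kinded support → crux
2026-08-16 for the crux-only deciding theorem) — (card R(iv) repaired: Coleman–Noll with EQUALITY by
Loschmidt reflection + hydrostatic pin; pure PDE/calculus, provable now) for η₀, σ > 0 with σ³ < η₀,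
hsExcessFreeEnergy C^∞ on (0,η₀) and r ↦ r·Z(rσ³) with positive derivative for rσ³ < η₀: if a C^∞
pressure law p̃ on {ρ>0, ρσ³<η₀, θ>0} is (WP) locally solvable from smooth positive normalised (∫ρ =
1) dilute data, (ENT) every classical Euler[p̃] solution from such data with packing < η₀ on [0,T)
has non-decreasing total hs-entropy, and (HYD) every such solution from REST data isobaric for
hsPressure σ is constant in time, then p̃ = hsPressure σ on the whole dilute state space. Proof:
d/dt S at 0⁺ = ∫(p_hs−p̃)θ⁻¹ div u ≥ 0 for data (ρ₀,u₀,θ₀) and (ρ₀,−u₀,θ₀) ⇒ = 0 ⇒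
(p_hs−p̃)(ρ₀,θ₀)/θ₀ has zero weak gradient ⇒ constant along every admissible profile ⇒
(attainability of any two state points by one normalised profile, since σ³ < η₀) p̃ = p_hs − cθ; HYD
at a non-isothermal isobaric rest profile (implicit function from monotonicity, IVT for the
normalisation) gives c∇θ₀ = 0 ⇒ c = 0. [difficulty: provable-now, M] (why it might fail: rigidity as
typed needs every dilute state point on ONE smooth normalised (∫ρ = 1) profile, a normalised
NON-isothermal hsPressure-isobaric rest profile inside the guard, and the entropy-production
identity through the one-sided timeDerivWithin at t = 0 — else a second degeneracy beyond p_hs − cθ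
survives or c is not pinned.) [ColemanNoll1963, Serrin1959, TruesdellNoll2004, Majda1984]
#9 LocalGibbsRealisability (crux, rank 9; re-kinded support → crux 2026-08-16) — (statics: inverse
of the local-Gibbs LLN map) ∃ η₀ > 0 ∀ σ > 0, every continuous positive normalised (∫ρ_V = 1)
profile V = (ρ_V,u_V,θ_V) with ρ_Vσ³ < η₀ is the t = 0 LLN limit of the local Gibbs laws
localGibbsLaw σ a₀ u_V θ_V for some continuous positive activity a₀ with a₀ ≤ 2ρ_V∫a₀ (so packing
guards become activity guards), these laws being probability measures for every N and flow.
Low-density cluster expansion: ρ[a] = a e^(−μ_ex)/C, a contraction for the inverse; strengthens the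
proved Literature fact localGibbs_lln_holds by identifying and inverting the limit density.
[difficulty: M] (why it might fail: uniformity — it must hold for EVERY σ with ρ_Vσ³ < η₀ whatever
the oscillation of V, while the in-tree canonical cluster expansion
(HardSphereEulerLLN.exists_smallDensity, PulvirentiTsagkarogiannis2012) needs 4eMθ/(1−θ) < min β:
near-vacuum corners of ρ_V may defeat the contraction of the inverse activity map, and e^{μ_ex} ≤ 2
(a₀ ≤ 2ρ_V∫a₀) needs η₀ small.) [Ruelle1969, LebowitzPenrose1964, Spohn1991,
PulvirentiTsagkarogiannis2012]
#9 HsEosLowDensity (support; CLOSED — proved in tree by Theorems.hsEosLowDensity_proof; consumed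
inside the proofs of RigidityBridge / Assembly, where it supplies the EOS hypotheses of
IsentropicSelection) — (shared, stmt 0768) analyticity of the hard-sphere excess free energy at low
density with F(0) = 0, F′(0) = 2π/3 and existence of the canonical thermodynamic limit; gives
smoothness of hsPressure and ∂_ρ(ρZ(ρσ³)) > 0 at small packing, the EOS hypotheses of
IsentropicSelection. [difficulty: L] [Ruelle1969, LebowitzPenrose1964]
(dropped 2026-08-16, statement re-type p126922) DiluteSelfConsistency (shared, stmt 3091: σ-uniform
packing bound ρσ³ < η along classical hs-Euler solutions from local-Gibbs data) used to turn
HydroLimitInBand into the then-UNGUARDED conjunct inside `closes`; the re-typed Statement carries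
the guard itself, so the item is no longer load-bearing here and was dropped from this route (it
stays wanted by its other routes; nothing of this line depended on it).
#9 RigidityBridge (crux, rank 9; re-kinded support → crux 2026-08-16: the unproved derivation cruxes
→ Statement is itself a crux under the crux-only invariant; restated the same day WITHOUT the proved
antecedent HsEosLowDensity, now consumed inside its proof, stmt 13754 → 17759) — (the route's inner
glue, provable now modulo its antecedents; since the re-type its conclusion HydroLimitInBand IS the
Statement's body, so it coincides in content with the Assembly item) AutonomousClosure →
LimitSecondLaw → HydrostaticRung → IsentropicSelection → LocalGibbsRealisability → HydroLimitInBand.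
Proof: η₀ := min(η_A, η_S/2, η_H/2, η_R, η_M) with η_M from the proved hsEosLowDensity_proof (f_ex
C^∞ on (0,η_M), 1+2ηF′+η²F″ > 0); given profiles take σ₀ := min(η₀^(1/3), σ₀′) with σ₀′ from the
PROVED localGibbs_lln_holds (laws are probability measures, so LLN at 0 with χ ≡ 1 forces ∫ρ(0) =
1); for σ < σ₀ instantiate IsSol, take p̃_σ from AutonomousClosure, verify (WP), (ENT) from
LocalGibbsRealisability + CONV + LimitSecondLaw (activity guard a₀σ³ ≤ 2ρσ³∫a₀ < η_S∫a₀; slices of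
smooth solutions are continuous), (HYD) from LocalGibbsRealisability + HydrostaticRung + CONV +
uniqueness of limits in probability (continuous profiles with equal integrals against all continuous
χ coincide); IsentropicSelection gives p̃_σ = hsPressure σ on the dilute state space, so a guarded
classical hs-Euler solution is an Euler[p̃_σ] solution (funext on the pressure composite) and CONV
yields the LLN at every t < T. [difficulty: M] (why it might fail: bookkeeping only if the typings
match literally — (HYD) needs uniqueness of TendstoHydroFieldsAt limits among continuous profiles
under probability laws, (ENT) needs ∫ρ(0) = 1 from the LLN with χ ≡ 1 and continuous positive
solution slices, and the activity guard a₀σ³ < η_S∫a₀ must follow from a₀ ≤ 2ρ∫a₀ with ρσ³ < η_S/2;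
a mismatch between the two bound IsSol predicates or the guards leaves it unprovable as typed.)
[Spohn1991, Kato1975]

TWO-LAYER PLAN. AutonomousClosure ⇐ PureAutonomy (deterministic continuous limit paths +
restart/universality for
local-Gibbs data, typable with TendstoHydroFieldsAt alone) → LightConeLocality (law-level finite
propagation speed) → AutonomousClosure, glued by the card's FORM RIGIDITY R(i)–(iii): locality +
translation / integer-dilation covariance + C¹ generator ⇒ first-order quasilinear; conservation for
all data ⇒ conservation form (closed 1-forms); cubic + Galilean covariance + exact continuity
equation ⇒ Euler form with p̃(ρ,θ) and zero heat flux (macro-flow vocabulary = a definition request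
deferred until a grounder asks). LimitSecondLaw ⇐ CanonicalHsStaticLDP (Georgii-type, packing < η₀)
→ LocalGibbsRelEntropyRate (H(LG|G_N)/N → I_β(V)) → LimitSecondLaw (glue: Liouville invariance +
configEnergy_eq_holds + entropy inequality). HydrostaticRung ⇐ ContactPressureIdentity (virial
theorem (3.15) at packing < η₀, static) → RestStateCurrentBound (σ-uniform o(1) time-integrated
heat/momentum current) → HydrostaticRung; if RestStateCurrentBound stalls, two REPLACEMENT PINS are
foreseen, each sufficient for c = 0 inside IsentropicSelection with (HYD) swapped: (a)
InitialSlopeRung — the expected empirical momentum field of rest local-Gibbs data has initial slope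
∫p_hs(ρ₀,θ₀)∇χ with an o(t) remainder uniform in N (static Enskog collisional-transfer computation +
entropy-production bound H(μ_t|LG) ≤ CNt + entropy inequality); (b) VacuumCornerRung — a kinematic
bound |Δ_t ∫χ·ρu| ≤ K∫₀ᵗ∫|∇χ|(E + p-part) on the limit, which kills the spurious momentum source c∇θ
where ρ₀ → 0. k ≤ 3 each, depth 1; nothing here is filed now.

KILL CRITERIA. AutonomousClosure refuted (a local-Gibbs family whose macroscopic future depends on
more than
(ρ,u,θ) — surviving dependence on the velocity shape of the data, or non-convergence of the energy
field at fixed packing) closes the route `refuted:AutonomousClosure` and is strong evidence against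
the conjunct itself. HydrostaticRung refuted = the conjunct fails in its hydrostatic sector: close,
and file ¬HydroLimitInBand with the witness. LimitSecondLaw can only die with Georgii-type statics
for canonical hard spheres — then pivot to the grand-canonical / periodic-box LDP form with an
explicit ensemble-equivalence support item (restate, not re-file). IsentropicSelection refuted (a
second degeneracy beyond p_hs − cθ, e.g. frame-dependent p̃) forces a pivot: add the missing static
pin as a further crux. LocalGibbsRealisability refuted as typed (vacuum-corner uniformity) ⇒
restate with an oscillation bound on V (min ρ_V ≥ κ·max ρ_V): every use inside RigidityBridge is
for slices of classical solutions on compact [0,t] × 𝕋³, which have positive minima — misstated,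
never substantive. RigidityBridge refuted as typed can only be a typing mismatch between the bound
IsSol predicates / guards — repaired by restating the offending antecedent. Since the 2026-08-16
re-type the implosion programme (DenseExcursion /
¬DiluteSelfConsistency, ImplosionLoophole–ImplosionDichotomy lines) no longer bears on this route:
reaching HydroLimitInBand IS deciding the Statement. HydroLimitInBand proved elsewhere (shared item)
moots the route (closes fires anyway).

NOT DECOMPOSED YET. The macro-flow vocabulary and the form-rigidity theorem (layer-2 children of
AutonomousClosure); the
uniform-integrability module for the energy field (shared a-priori input of every route,
apriori-tails-and-rattlers); inside RigidityBridge / IsentropicSelection: uniqueness of limits in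
probability for continuous profiles, slice continuity `IsSmoothSpaceTimeOn.isSmooth_slice`, the
restriction lemma IsSol p T → IsSol p T′ (T′ ≤ T, derivWithin on the smaller interval), positivity
of ∫a₀, attainability profiles, the implicit-function / IVT construction of a normalised
non-isothermal isobaric rest profile, and the entropy-production identity ρθ Ds/Dt = (p_hs − p̃) div
u (lemmas attached with --supports, never items); constants η₀, σ₀ are existential throughout and
never computed; the replacement pins of the Two-layer plan.

CHEAPEST FALSIFIER. (i) ALGEBRA (minutes, refuter): redo the selection step allowing p̃ to depend on
(ρ,θ) arbitrarily
and on the cubic frame: is p_hs − cθ the ONLY family conserving ∫ρ s_hs along all smooth Euler[p̃]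
flows on 𝕋³? (planner's computation: ρθ Ds/Dt = (p_hs − p̃) div u, so ∫(p_hs−p̃)θ⁻¹div u = 0 for all
data forces (p_hs−p̃)/θ ≡ c; then d/dt∫ρs = c∫div u = 0 — c is invisible to entropy and is killed
only by HYD) — a second degeneracy kills IsentropicSelection as stated. (ii) LOOKUP: a printed
hidden conserved field / non-Gibbs regular stationary state for 3-D hard spheres at positive density
would kill AutonomousClosure (none known; ideal gas and hard rods are the catalogued kernels and are
excluded by genuine collisions). (iii) MD (kit, hours; not run — plancard seat): isobaric
non-isothermal rest local-Gibbs data at φ = 0.05–0.1, N = 10⁵–10⁶: an N-independent O(1) drift of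
the density profile over t = O(1) kills HydrostaticRung; a macroscopic Loschmidt echo with
N-independent pre-shock fidelity deficit kills the card's (A-rev) reading of AutonomousClosure.

NUMBERS. Z(η) = 1 + (2π/3)η + O(η²) (second virial coefficient of unit-diameter spheres,
HsEosLowDensity /
LebowitzPenrose1964); hard-sphere freezing at packing fraction ≈ 0.494 (ρσ³ ≈ 0.943) bounds any
admissible η₀ far above the cluster radius actually used; c_v = 3/2, E = ρ(|u|²/2 + 3θ/2), s_hs =
3/2 log θ − log ρ − f_ex(ρσ³), p_hs = ρθZ(ρσ³) (Gibbs relation ρ²∂_ρ s = −Z, ∂_θ s = 3/(2θ));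
entropy production of Euler[p̃] against s_hs: ρθ Ds/Dt = (p_hs − p̃) div u; for p̃ = p_hs − cθ: D(s
− c/ρ)/Dt = 0 and d/dt∫ρ s = 0. Mean free path at fixed σ: (N+1)^(−1/3)/(√2πσ²·ρ) → 0, i.e. ≍
N^(1/3) collisions per particle per unit macroscopic time. Items at open: 10 (1 target, 3 cruxes, 5
support, 1 assembly); after the 2026-08-16 repair: 9 (1 target, 6 cruxes, 1 support =
HsEosLowDensity (proved), 1
assembly; DiluteSelfConsistency dropped, Assembly restated, IsentropicSelection /
LocalGibbsRealisability / RigidityBridge re-kinded support → crux for the crux-only deciding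
theorem, RigidityBridge restated without its proved EOS antecedent — `closes` has 6 hypotheses,
all cruxes; item ids after the repair: HydroLimitInBand 9133, AutonomousClosure 13749,
LimitSecondLaw 13750, HydrostaticRung 13751, IsentropicSelection 13752, LocalGibbsRealisability
13753, RigidityBridge 17759 (was 13754), HsEosLowDensity 0768, Assembly 17760 (was 13755/17648)).

DEFINITION REQUESTS. None filed at open. Deferred (for the foreseen split of AutonomousClosure): a
macro-flow vocabulary
`IsAutonomousHydroLimit σ S` / `MacroFlowAxioms` under
Summits/AtomisticToContinuum/HydrodynamicLimit/Theorems, and a general-EOS classical Euler predicate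
`IsEulerSolutionEOS p T ρ u θ` in Literature/MathematicalPhysics/KineticTheory (here inlined once
per Prop through a bound predicate `IsSol` with its defining ↔, so no item waits on it).

Novelty: Searches (2026-08-15, this seat): `lit search --hybrid "autonomous macroscopic evolution H-theorem
time reversal entropy equation of state"` (10 book hits, vector leg only: Gallavotti 2014, Jancel
1963, Cencini–Puglisi–Vulpiani 2021, Hemmo–Shenker 2012 … — foundations / H-theorem discussions,
none derives an EOS from autonomy); `lit search --source crossref "H-theorems from macroscopic
autonomous equations De Roeck Maes Netocny"` (6: doi:10.1007/s10955-006-9079-x located; Maes–Netočný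
minimum entropy production 2013); `lit citing doi:10.1007/s10955-006-9079-x` (26 citers:
arXiv:2111.10348 macroscopic stability of Gibbs evolutions, arXiv:1706.10115 GENERIC from a
fluctuation symmetry, arXiv:2109.06434 Kac ring, arXiv:1904.10485 frenesy — none runs autonomy
forward to select a constitutive law); `lit frontier AtomisticToContinuum --since 2021` (30 rows:
Bose gas, Deng–Hani–Ma expositions arXiv:2602.04407, heat equation from deterministic dynamics
arXiv:2310.13338 — diffusive, different conjunct shape); `lit galaxy search "autonomous macroscopic
equations H-theorem reversibility" --star all` and two variants (0 rows, substring mode); s2 / arxiv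
/ openalex / zbmath rate-limited (429 / 0 rows) — recorded in NOTES.md. Inherited and re-read: the
card's audit (RoeckMaesNetocny2006 pp. 3–6 read; 51 cards grep'd) and the retired route's searches
(hybrid 12 book hits; ColemanNoll1963 and Serrin1959 located and added to bib; Spohn1991 PDF pp. 40,
43, 53).
Nearest prior art found: RoeckMa  [refs: 10.1007/s10955-006-9079-x, 10.1007/s10955-006-9079-x`, 2111.10348, 1706.10115, 2109.06434, 1904.10485, 2602.04407, 2310.13338, cond-mat/0508089, doi:10.1007/s10955-006-9079-x, RoeckMaesNetocny2006, ColemanNoll1963, Serrin1959, Spohn1991]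

Barriers (technique_class: reversibility-rigidity, autonomy, entropy-selection): - technique_class: reversibility-rigidity, autonomy, entropy-selection
- Literature.Barriers.AtomisticToContinuum.VelocityReversalBarrier: not met at the microscopic level
— no every-phase-point derivation, no reversal-closed hypothesis class
(VelocityReversalBarrierNarrow: the kernel needs z ∈ G and R(Φ_t z) ∈ G); reversal is used only on
the macroscopic PDE (data (ρ,u,θ) ↦ (ρ,−u,θ); Euler[p̃] is reversible for every p̃ while smooth) and
convergence is in probability at both ends for LAWS; every item is pre-shock, where the barrier's
scope caveat (b) says the conjunct is not blocked.
- Literature.Barriers.AtomisticToContinuum.BoltzmannHypothesisBarrier: no stationary-state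
classification and no entropy METHOD is used; its kernels (ideal gas: future depends on h(v); hard
rods: extra fields) violate AutonomousClosure, which therefore genuinely consumes collisions —
conceded that the hidden-slow-variable obstruction re-enters inside AutonomousClosure's proof (its
why-might-fail).
- Literature.Barriers.AtomisticToContinuum.MacroErgodicityBarrier: not met (no ergodic or mixing
input; the second law comes from statics + Liouville; the rung is a hydrostatic, not an ergodic,
statement).
- Literature.Barriers.AtomisticToContinuum.HighMomentumCutoffBarrier: APPLIES to the energy field in
AutonomousClosure (σ-uniform velocity-tail control along the dynamics); not evaded, declared in its
why-might-fail; LimitSecondLaw needs only exponential tightness of the kinetic energy under local Gi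

History (route lifecycle, newest last):
- 2026-08-16T23:25:15Z · rev 4: restated Assembly (stmt-AtomisticToContinuum-13755) — route-repair (statement-revised, p126922): the Statement is now the packing-guarded conjunct = this route's target HydroLimitInBand VERBATIM, so `closes` := Rig (planner-rrepair-AtomisticToContinuum-Loschmidt-d4d0fbe0-0)
- 2026-08-16T23:25:15Z · rev 4: dropped DiluteSelfConsistency — route-repair (statement-revised, p126922): the Statement is now the packing-guarded conjunct = this route's target HydroLimitInBand VERBATIM, so `closes` := Rig (planner-rrepair-AtomisticToContinuum-Loschmidt-d4d0fbe0-0)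
- 2026-08-16T23:34:21Z · rev 5: restated RigidityBridge (stmt-AtomisticToContinuum-13754), Assembly (stmt-AtomisticToContinuum-17648) — route-repair pass 2a: RigidityBridge restated without the PROVED antecedent HsEosLowDensity (consumed inside its proof via hsEosLowDensity_proof) so that, once (planner-rrepair-AtomisticToContinuum-Loschmidt-d4d0fbe0-0)
- 2026-08-23T19:08:35Z · DORMANT — reconciler: no traction for 6.2 d (last activity item-evidence-added at 2026-08-17T14:22:40Z); parked, not closed — `ledger route dormant route-AtomisticToConti (operator:999:949254)

sub-problem: HydrodynamicLimit · status: dormant · opened planner-plancard-AtomisticToContinuum-Hydrody-4509dc37-g2-0 2026-08-15T19:03:03Z · rev 10 · ledger route-AtomisticToContinuum-LoschmidtIsentropicSelection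
GENERATED by the gate from the ledger (D-0016/17). Provers cite these decls: `theorem foo : Summit.AtomisticToContinuum.HydrodynamicLimit.Theses.LoschmidtIsentropicSelection.<Decl> := …` in Summits/AtomisticToContinuum/HydrodynamicLimit/Theorems/<Name>.lean.
-/

namespace Summit.AtomisticToContinuum.HydrodynamicLimit.Theses.LoschmidtIsentropicSelection

open scoped BigOperators Topology Manifold Classical MeasureTheory ProbabilityTheory Matrix InnerProductSpace ComplexConjugate ContinuousMap
open Filter Set Function TopologicalSpace MeasureTheory

attribute [summit_statement] _root_.HydrodynamicLimit

/-- item stmt-AtomisticToContinuum-9133 · target · rank 0 · open · by planner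
why it might fail: It is the conjunct minus the implosion loophole — since the 2026-08-16 re-type literally the sub-problem Statement: a hidden slow field, anomalous transport at Euler scale, or failure of propagation of local equilibrium for deterministic hard spheres would refute it.
sources: Spohn1991, OllaVaradhanYau1993
[support] (shared, stmt 3093) the packing-guarded conjunct: ∃ η₀ > 0 such that HydrodynamicLimit's
conclusion holds for all classical solutions with ρ_t(x)σ³ < η₀ on [0,T) × 𝕋³. Delivered here by
ShadowingToBand ∘ LaxShadowing. [difficulty: open-problem] -/
@[route_item "route-AtomisticToContinuum-LoschmidtIsentropicSelection"]
def HydroLimitInBand : Prop :=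
  ∃ η₀ : ℝ, 0 < η₀ ∧ ∀ (a₀ θ₀ : Literature.MathematicalPhysics.KineticTheory.T3 → ℝ) (u₀ : Literature.MathematicalPhysics.KineticTheory.T3 → Literature.MathematicalPhysics.KineticTheory.V3), Continuous a₀ → Continuous θ₀ → Continuous u₀ → (∀ x, 0 < a₀ x) → (∀ x, 0 < θ₀ x) → ∃ σ₀ : ℝ, 0 < σ₀ ∧ ∀ σ : ℝ, 0 < σ → σ < σ₀ → ∀ (T : ℝ) (ρ θ : ℝ → Literature.MathematicalPhysics.KineticTheory.T3 → ℝ) (u : ℝ → Literature.MathematicalPhysics.KineticTheory.T3 → Literature.MathematicalPhysics.KineticTheory.V3), Literature.MathematicalPhysics.KineticTheory.IsHardSphereEulerSolution σ T ρ u θ → (∀ t ∈ Set.Ico 0 T, ∀ x, ρ t x * σ ^ 3 < η₀) → ∀ Φ : (N : ℕ) → Literature.Analysis.FluidPDE.HardSphereFlow (Literature.Analysis.FluidPDE.Torus.geometry (Fin 3)) (Literature.MathematicalPhysics.KineticTheory.hsDiameter σ N) (N + 1), Literature.MathematicalPhysics.KineticTheory.TendstoHydroFieldsAt (fun N => Literature.MathematicalPhysics.KineticTheory.localGibbsLaw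 σ a₀ u₀ θ₀ N (Φ N)) Φ ρ u θ 0 → ∀ t ∈ Set.Ico 0 T, Literature.MathematicalPhysics.KineticTheory.TendstoHydroFieldsAt (fun N => Literature.MathematicalPhysics.KineticTheory.localGibbsLaw σ a₀ u₀ θ₀ N (Φ N)) Φ ρ u θ t

/-- item stmt-AtomisticToContinuum-13749 · crux · rank 2 · open · by planner
why it might fail: A hidden slow extensive field (ideal-gas h(v), hard-rod type) or surviving dependence on the velocity SHAPE of the data leaves no closed (ρ,u,θ) system; the energy field needs σ-uniform velocity-tail control (HighMomentumCutoff); with p̃ := hsPressure it is the guarded conjunct itself.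
sources: Spohn1991, RoeckMaesNetocny2006, OllaVaradhanYau1993, Serrin1959
[crux] (card item A with the Euler FORM folded in; EOS-agnostic) ∃ η₀ > 0 ∀ σ > 0 ∃ a pressure law
p̃(ρ,θ), C^∞ on {ρ > 0, ρσ³ < η₀, θ > 0}, such that (WP) Euler[p̃] with E = ρ(|u|²/2+3θ/2) has a
classical solution on some [0,T), T > 0, from every smooth positive datum with packing < η₀, and
(CONV) for all continuous positive local-Gibbs profiles (a₀,u₀,θ₀), every classical Euler[p̃]
solution on [0,T) with packing < η₀ and every flow family whose laws are probability measures: LLN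
of the three fields at t = 0 ⇒ LLN at every t < T. The classical-solution predicate for a general
pressure law is bound once inside the Prop (`∀ IsSol, (∀ p T ρ u θ, IsSol p T ρ u θ ↔ ⟨the eight
clauses of IsHardSphereEulerSolution with hsPressure σ replaced by p⟩) → …`). [difficulty:
open-problem] -/
@[route_item "route-AtomisticToContinuum-LoschmidtIsentropicSelection", crux]
def AutonomousClosure : Prop :=
  ∀ IsSol : (ℝ → ℝ → ℝ) → ℝ → (ℝ → Literature.MathematicalPhysics.KineticTheory.T3 → ℝ) → (ℝ → Literature.MathematicalPhysics.KineticTheory.T3 → Literature.MathematicalPhysics.KineticTheory.V3) → (ℝ → Literature.MathematicalPhysics.KineticTheory.T3 → ℝ) → Prop, (∀ p T ρ u θ, IsSol p T ρ u θ ↔ (Literature.Analysis.FunctionSpaces.Torus.IsSmoothSpaceTimeOn (Set.Ico 0 T) ρ ∧ Literature.Analysis.FunctionSpaces.Torus.IsSmoothSpaceTimeOn (Set.Ico 0 T) u ∧ Literature.Analysis.FunctionSpaces.Torus.IsSmoothSpaceTimeOn (Set.Ico 0 T) θ ∧ (∀ t ∈ Set.Ico 0 T, ∀ x, 0 < ρ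 t x) ∧ (∀ t ∈ Set.Ico 0 T, ∀ x, 0 < θ t x) ∧ (∀ t ∈ Set.Ico 0 T, ∀ x, Literature.Analysis.FunctionSpaces.Torus.timeDerivWithin (Set.Ico 0 T) ρ t x + Literature.Analysis.FunctionSpaces.Torus.divergence (fun y => ρ t y • u t y) x = 0) ∧ (∀ t ∈ Set.Ico 0 T, ∀ x, Literature.Analysis.FunctionSpaces.Torus.timeDerivWithin (Set.Ico 0 T) (fun s y => ρ s y • u s y) t x + (∑ i, Literature.Analysis.FunctionSpaces.Torus.partialDeriv i (fun y => (ρ t y * u t y i) • u t y) x) + Literature.Analysis.FunctionSpaces.Torus.gradient (fun y => p (ρ t y) (θ t y)) x = 0) ∧ (∀ t ∈ Set.Ico 0 T, ∀ x, Literature.Analysis.FunctionSpaces.Torus.timeDerivWithin (Set.Ico 0 T) (fun s y => Literature.MathematicalPhysics.KineticTheory.totalEnergyDensity (ρ s y) (u s y) (θ s y)) t x + Literature.Analysis.FunctionSpaces.Torus.divergence (fun y => (Literature.MathematicalPhysics.KineticTheory.totalEnergyDensity (ρ t y) (u t y) (θ t y) + p (ρ t y) (θ t y)) • u t y) x = 0)))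 → ∃ η₀ : ℝ, 0 < η₀ ∧ ∀ σ : ℝ, 0 < σ → ∃ p : ℝ → ℝ → ℝ, ContDiffOn ℝ (⊤ : ℕ∞) (fun q : ℝ × ℝ => p q.1 q.2) {q : ℝ × ℝ | 0 < q.1 ∧ q.1 * σ ^ 3 < η₀ ∧ 0 < q.2} ∧ (∀ (ρ₀ θ₀ : Literature.MathematicalPhysics.KineticTheory.T3 → ℝ) (u₀ : Literature.MathematicalPhysics.KineticTheory.T3 → Literature.MathematicalPhysics.KineticTheory.V3), Literature.Analysis.FunctionSpaces.Torus.IsSmooth ρ₀ → Literature.Analysis.FunctionSpaces.Torus.IsSmooth θ₀ → Literature.Analysis.FunctionSpaces.Torus.IsSmooth u₀ → (∀ x, 0 < ρ₀ x) → (∀ x, 0 < θ₀ x) → (∀ x, ρ₀ x * σ ^ 3 < η₀) → ∃ T : ℝ, 0 < T ∧ ∃ (ρ θ : ℝ → Literature.MathematicalPhysics.KineticTheory.T3 → ℝ) (u : ℝ → Literature.MathematicalPhysics.KineticTheory.T3 → Literature.MathematicalPhysics.KineticTheory.V3), IsSol p T ρ u θ ∧ ρ 0 = ρ₀ ∧ u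 0 = u₀ ∧ θ 0 = θ₀) ∧ ∀ (a₀ θ₀ : Literature.MathematicalPhysics.KineticTheory.T3 → ℝ) (u₀ : Literature.MathematicalPhysics.KineticTheory.T3 → Literature.MathematicalPhysics.KineticTheory.V3), Continuous a₀ → Continuous θ₀ → Continuous u₀ → (∀ x, 0 < a₀ x) → (∀ x, 0 < θ₀ x) → ∀ (T : ℝ) (ρ θ : ℝ → Literature.MathematicalPhysics.KineticTheory.T3 → ℝ) (u : ℝ → Literature.MathematicalPhysics.KineticTheory.T3 → Literature.MathematicalPhysics.KineticTheory.V3), IsSol p T ρ u θ → (∀ t ∈ Set.Ico 0 T, ∀ x, ρ t x * σ ^ 3 < η₀) → ∀ Φ : (N : ℕ) → Literature.Analysis.FluidPDE.HardSphereFlow (Literature.Analysis.FluidPDE.Torus.geometry (Fin 3)) (Literature.MathematicalPhysics.KineticTheory.hsDiameter σ N) (N + 1), (∀ N, MeasureTheory.IsProbabilityMeasure (Literature.MathematicalPhysics.KineticTheory.localGibbsLaw σ a₀ u₀ θ₀ N (Φ N))) → Literature.MathematicalPhysics.KineticTheory.TendstoHydroFieldsAt (fun N => Literature.MathematicalPhysics.KineticTheory.localGibbsLaw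 σ a₀ u₀ θ₀ N (Φ N)) Φ ρ u θ 0 → ∀ t ∈ Set.Ico 0 T, Literature.MathematicalPhysics.KineticTheory.TendstoHydroFieldsAt (fun N => Literature.MathematicalPhysics.KineticTheory.localGibbsLaw σ a₀ u₀ θ₀ N (Φ N)) Φ ρ u θ t

/-- item stmt-AtomisticToContinuum-13750 · crux · rank 3 · open · by planner
why it might fail: Needs the static LD principle and H(LG|G_N)/N → I(V) for the CANONICAL hard-sphere law on 𝕋³ with Maxwellian marks, uniformly at packing < η₀ (GeorgiiZessin1993/Georgii1994 are grand-canonical, infinite volume); exponential tightness of the kinetic-energy field is also used.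
sources: RoeckMaesNetocny2006, GeorgiiZessin1993, Georgii1994, KipnisLandim1999, Ruelle1969
[crux] (card (P3), the free second law for deterministic limits) ∃ η₀ > 0 ∀ σ > 0, for continuous
positive local-Gibbs profiles (a₀,u₀,θ₀) under the activity guard a₀σ³ < η₀∫a₀, all continuous
positive profiles V = (ρ_V,u_V,θ_V), Q = (ρ_Q,u_Q,θ_Q) with packing < η₀, every flow family with the
laws probability measures and every t ≥ 0: fields → V in probability at time 0 and → Q at time t ⇒
∫ρ_V(3/2 log θ_V − log ρ_V − f_ex(ρ_Vσ³)) ≤ ∫ρ_Q(3/2 log θ_Q − log ρ_Q − f_ex(ρ_Qσ³)) (f_ex =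
hsExcessFreeEnergy). Mechanism: H(LG|G_N,β)/(N+1) → I_β(V), G_N invariant under every HardSphereFlow
(Liouville + configEnergy_eq_holds), static LD upper bound G_N(fields ≈ Q) ≤ e^(−N I_β(Q)+o(N)),
entropy inequality P(A) ≤ (H+log 2)/log(1+1/G(A)); I_β = βE − S_hs + const and E(Q) = E(V) exactly
(χ ≡ 1, energy conservation). [difficulty: L] -/
@[route_item "route-AtomisticToContinuum-LoschmidtIsentropicSelection", crux]
def LimitSecondLaw : Prop :=
  ∃ η₀ : ℝ, 0 < η₀ ∧ ∀ σ : ℝ, 0 < σ → ∀ (a₀ θ₀ : Literature.MathematicalPhysics.KineticTheory.T3 → ℝ) (u₀ : Literature.MathematicalPhysics.KineticTheory.T3 → Literature.MathematicalPhysics.KineticTheory.V3), Continuous a₀ → Continuous θ₀ → Continuous u₀ → (∀ x, 0 < a₀ x) → (∀ x, 0 < θ₀ x) → (∀ x, a₀ x * σ ^ 3 < η₀ * ∫ y, a₀ y) → ∀ (ρV θV : Literature.MathematicalPhysics.KineticTheory.T3 → ℝ) (uV : Literature.MathematicalPhysics.KineticTheory.T3 → Literature.MathematicalPhysics.KineticTheory.V3)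 (ρQ θQ : Literature.MathematicalPhysics.KineticTheory.T3 → ℝ) (uQ : Literature.MathematicalPhysics.KineticTheory.T3 → Literature.MathematicalPhysics.KineticTheory.V3), Continuous ρV → Continuous θV → Continuous uV → Continuous ρQ → Continuous θQ → Continuous uQ → (∀ x, 0 < ρV x) → (∀ x, 0 < θV x) → (∀ x, 0 < ρQ x) → (∀ x, 0 < θQ x) → (∀ x, ρV x * σ ^ 3 < η₀) → (∀ x, ρQ x * σ ^ 3 < η₀) → ∀ Φ : (N : ℕ) → Literature.Analysis.FluidPDE.HardSphereFlow (Literature.Analysis.FluidPDE.Torus.geometry (Fin 3)) (Literature.MathematicalPhysics.KineticTheory.hsDiameter σ N) (N + 1), (∀ N, MeasureTheory.IsProbabilityMeasure (Literature.MathematicalPhysics.KineticTheory.localGibbsLaw σ a₀ u₀ θ₀ N (Φ N))) → ∀ t : ℝ, 0 ≤ t → Literature.MathematicalPhysics.KineticTheory.TendstoHydroFieldsAt (fun N => Literature.MathematicalPhysics.KineticTheory.localGibbsLaw σ a₀ u₀ θ₀ N (Φ N)) Φ (fun _ => ρV) (fun _ => uV) (fun _ => θV) 0 → Literature.MathematicalPhysics.KineticTheory.TendstoHydroFieldsAt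 (fun N => Literature.MathematicalPhysics.KineticTheory.localGibbsLaw σ a₀ u₀ θ₀ N (Φ N)) Φ (fun _ => ρQ) (fun _ => uQ) (fun _ => θQ) t → ∫ x, ρV x * (3 / 2 * Real.log (θV x) - Real.log (ρV x) - Literature.MathematicalPhysics.KineticTheory.hsExcessFreeEnergy (ρV x * σ ^ 3)) ≤ ∫ x, ρQ x * (3 / 2 * Real.log (θQ x) - Real.log (ρQ x) - Literature.MathematicalPhysics.KineticTheory.hsExcessFreeEnergy (ρQ x * σ ^ 3))

/-- item stmt-AtomisticToContinuum-13751 · crux · rank 4 · open · by planner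
why it might fail: σ-uniform, all fixed t ≥ 0: an O(1) anomalous heat/momentum current in an isobaric rest state over N^(1/3) collision times, a linear-in-t drift from the initial layer, or local-Gibbs contact pressure ≠ ρθZ(ρσ³) (virial theorem) would break it.
sources: Spohn1991, LebowitzPenrose1964, Ruelle1969
[crux] (pins the pressure LEVEL c; the virial theorem in macroscopic clothing) ∃ η₀ > 0 ∀ σ > 0, for
continuous positive activity a₀ with a₀σ³ < η₀∫a₀, smooth positive θ₀, ρ₀ with ρ₀σ³ < η₀ and
hsPressure σ ρ₀ θ₀ ≡ const on 𝕋³, and every flow family with the rest local Gibbs laws localGibbsLaw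
σ a₀ 0 θ₀ probability measures: if the fields at time 0 converge in probability to (ρ₀, 0, ρ₀·3θ₀/2)
then they converge to the same static profile at every fixed t ≥ 0 (N → ∞ first). [difficulty: L] -/
@[route_item "route-AtomisticToContinuum-LoschmidtIsentropicSelection", crux]
def HydrostaticRung : Prop :=
  ∃ η₀ : ℝ, 0 < η₀ ∧ ∀ σ : ℝ, 0 < σ → ∀ (a₀ θ₀ ρ₀ : Literature.MathematicalPhysics.KineticTheory.T3 → ℝ), Continuous a₀ → Literature.Analysis.FunctionSpaces.Torus.IsSmooth θ₀ → Literature.Analysis.FunctionSpaces.Torus.IsSmooth ρ₀ → (∀ x, 0 < a₀ x) → (∀ x, 0 < θ₀ x) → (∀ x, 0 < ρ₀ x) → (∀ x, a₀ x * σ ^ 3 < η₀ * ∫ y, a₀ y) → (∀ x, ρ₀ x * σ ^ 3 < η₀) → (∀ x y, Literature.MathematicalPhysics.KineticTheory.hsPressure σ (ρ₀ x) (θ₀ x) = Literature.MathematicalPhysics.KineticTheory.hsPressure σ (ρ₀ y) (θ₀ y)) → ∀ Φ : (N : ℕ) → Literature.Analysis.FluidPDE.HardSphereFlow (Literature.Analysis.FluidPDE.Torus.geometry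 (Fin 3)) (Literature.MathematicalPhysics.KineticTheory.hsDiameter σ N) (N + 1), (∀ N, MeasureTheory.IsProbabilityMeasure (Literature.MathematicalPhysics.KineticTheory.localGibbsLaw σ a₀ (fun _ => 0) θ₀ N (Φ N))) → Literature.MathematicalPhysics.KineticTheory.TendstoHydroFieldsAt (fun N => Literature.MathematicalPhysics.KineticTheory.localGibbsLaw σ a₀ (fun _ => 0) θ₀ N (Φ N)) Φ (fun _ => ρ₀) (fun _ _ => 0) (fun _ => θ₀) 0 → ∀ t : ℝ, 0 ≤ t → Literature.MathematicalPhysics.KineticTheory.TendstoHydroFieldsAt (fun N => Literature.MathematicalPhysics.KineticTheory.localGibbsLaw σ a₀ (fun _ => 0) θ₀ N (Φ N)) Φ (fun _ => ρ₀) (fun _ _ => 0) (fun _ => θ₀) t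

/-- item stmt-AtomisticToContinuum-13752 · crux · rank 9 · open · by planner
why it might fail: As typed, rigidity needs every dilute state point on ONE smooth normalised profile, a normalised non-isothermal hsPressure-isobaric rest profile inside the guard, and the entropy-production identity via one-sided timeDerivWithin at t=0; else a degeneracy beyond p_hs − cθ survives or c is not pinned.
sources: ColemanNoll1963, Serrin1959, TruesdellNoll2004, Majda1984
[support] (card R(iv) repaired: Coleman–Noll with EQUALITY by Loschmidt reflection + hydrostatic
pin; pure PDE/calculus, provable now) for η₀, σ > 0 with σ³ < η₀, hsExcessFreeEnergy C^∞ on (0,η₀)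
and r ↦ r·Z(rσ³) with positive derivative for rσ³ < η₀: if a C^∞ pressure law p̃ on {ρ>0, ρσ³<η₀,
θ>0} is (WP) locally solvable from smooth positive normalised (∫ρ = 1) dilute data, (ENT) every
classical Euler[p̃] solution from such data with packing < η₀ on [0,T) has non-decreasing total
hs-entropy, and (HYD) every such solution from REST data isobaric for hsPressure σ is constant in
time, then p̃ = hsPressure σ on the whole dilute state space. Proof: d/dt S at 0⁺ = ∫(p_hs−p̃)θ⁻¹
div u ≥ 0 for data (ρ₀,u₀,θ₀) and (ρ₀,−u₀,θ₀) ⇒ = 0 ⇒ (p_hs−p̃)(ρ₀,θ₀)/θ₀ has zero weak gradient ⇒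
constant along every admissible profile ⇒ (attainability of any two state points by one normalised
profile, since σ³ < η₀) p̃ = p_hs − cθ; HYD at a non-isothermal isobaric rest profile (implicit
function from monotonicity, IVT for the normalisation) gives c∇θ₀ = 0 ⇒ c = 0. [difficulty:
provable-now] -/
@[route_item "route-AtomisticToContinuum-LoschmidtIsentropicSelection", crux]
def IsentropicSelection : Prop :=
  ∀ IsSol : (ℝ → ℝ → ℝ) → ℝ → (ℝ → Literature.MathematicalPhysics.KineticTheory.T3 → ℝ) → (ℝ → Literature.MathematicalPhysics.KineticTheory.T3 → Literature.MathematicalPhysics.KineticTheory.V3) → (ℝ → Literature.MathematicalPhysics.KineticTheory.T3 → ℝ) → Prop, (∀ p T ρ u θ, IsSol p T ρ u θ ↔ (Literature.Analysis.FunctionSpaces.Torus.IsSmoothSpaceTimeOn (Set.Ico 0 T) ρ ∧ Literature.Analysis.FunctionSpaces.Torus.IsSmoothSpaceTimeOn (Set.Ico 0 T) u ∧ Literature.Analysis.FunctionSpaces.Torus.IsSmoothSpaceTimeOn (Set.Ico 0 T) θ ∧ (∀ t ∈ Set.Ico 0 T, ∀ x, 0 < ρ t x) ∧ (∀ t ∈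 Set.Ico 0 T, ∀ x, 0 < θ t x) ∧ (∀ t ∈ Set.Ico 0 T, ∀ x, Literature.Analysis.FunctionSpaces.Torus.timeDerivWithin (Set.Ico 0 T) ρ t x + Literature.Analysis.FunctionSpaces.Torus.divergence (fun y => ρ t y • u t y) x = 0) ∧ (∀ t ∈ Set.Ico 0 T, ∀ x, Literature.Analysis.FunctionSpaces.Torus.timeDerivWithin (Set.Ico 0 T) (fun s y => ρ s y • u s y) t x + (∑ i, Literature.Analysis.FunctionSpaces.Torus.partialDeriv i (fun y => (ρ t y * u t y i) • u t y) x) + Literature.Analysis.FunctionSpaces.Torus.gradient (fun y => p (ρ t y) (θ t y)) x = 0) ∧ (∀ t ∈ Set.Ico 0 T, ∀ x, Literature.Analysis.FunctionSpaces.Torus.timeDerivWithin (Set.Ico 0 T) (fun s y => Literature.MathematicalPhysics.KineticTheory.totalEnergyDensity (ρ s y) (u s y) (θ s y)) t x + Literature.Analysis.FunctionSpaces.Torus.divergence (fun y => (Literature.MathematicalPhysics.KineticTheory.totalEnergyDensity (ρ t y) (u t y) (θ t y) + p (ρ t y) (θ t y)) • u t y) x = 0))) → ∀ η₀ σ : ℝ,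 let S : (Literature.MathematicalPhysics.KineticTheory.T3 → ℝ) → (Literature.MathematicalPhysics.KineticTheory.T3 → ℝ) → ℝ := fun ρ' θ' => ∫ x, ρ' x * (3 / 2 * Real.log (θ' x) - Real.log (ρ' x) - Literature.MathematicalPhysics.KineticTheory.hsExcessFreeEnergy (ρ' x * σ ^ 3)); 0 < η₀ → 0 < σ → σ ^ 3 < η₀ → ContDiffOn ℝ (⊤ : ℕ∞) Literature.MathematicalPhysics.KineticTheory.hsExcessFreeEnergy (Set.Ioo 0 η₀) → (∀ r : ℝ, 0 < r → r * σ ^ 3 < η₀ → 0 < deriv (fun r' : ℝ => r' * Literature.MathematicalPhysics.KineticTheory.hsCompressibility (r' * σ ^ 3)) r) → ∀ p : ℝ → ℝ → ℝ, ContDiffOn ℝ (⊤ : ℕ∞) (fun q : ℝ × ℝ => p q.1 q.2) {q : ℝ × ℝ | 0 < q.1 ∧ q.1 * σ ^ 3 < η₀ ∧ 0 < q.2} → (∀ (ρ₀ θ₀ : Literature.MathematicalPhysics.KineticTheory.T3 → ℝ) (u₀ : Literature.MathematicalPhysics.KineticTheory.T3 → Literature.MathematicalPhysics.KineticTheory.V3),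 Literature.Analysis.FunctionSpaces.Torus.IsSmooth ρ₀ → Literature.Analysis.FunctionSpaces.Torus.IsSmooth θ₀ → Literature.Analysis.FunctionSpaces.Torus.IsSmooth u₀ → (∀ x, 0 < ρ₀ x) → (∀ x, 0 < θ₀ x) → (∫ x, ρ₀ x = 1) → (∀ x, ρ₀ x * σ ^ 3 < η₀) → ∃ T : ℝ, 0 < T ∧ ∃ (ρ θ : ℝ → Literature.MathematicalPhysics.KineticTheory.T3 → ℝ) (u : ℝ → Literature.MathematicalPhysics.KineticTheory.T3 → Literature.MathematicalPhysics.KineticTheory.V3), IsSol p T ρ u θ ∧ ρ 0 = ρ₀ ∧ u 0 = u₀ ∧ θ 0 = θ₀) → (∀ (T : ℝ) (ρ θ : ℝ → Literature.MathematicalPhysics.KineticTheory.T3 → ℝ) (u : ℝ → Literature.MathematicalPhysics.KineticTheory.T3 → Literature.MathematicalPhysics.KineticTheory.V3), IsSol p T ρ u θ → (∫ x, ρ 0 x = 1) → (∀ t ∈ Set.Ico 0 T, ∀ x, ρ t x * σ ^ 3 < η₀) → ∀ t ∈ Set.Ico 0 T, S (ρ 0) (θ 0) ≤ S (ρ t)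 (θ t)) → (∀ (T : ℝ) (ρ θ : ℝ → Literature.MathematicalPhysics.KineticTheory.T3 → ℝ) (u : ℝ → Literature.MathematicalPhysics.KineticTheory.T3 → Literature.MathematicalPhysics.KineticTheory.V3), IsSol p T ρ u θ → (u 0 = fun _ => 0) → (∫ x, ρ 0 x = 1) → (∀ t ∈ Set.Ico 0 T, ∀ x, ρ t x * σ ^ 3 < η₀) → (∀ x y, Literature.MathematicalPhysics.KineticTheory.hsPressure σ (ρ 0 x) (θ 0 x) = Literature.MathematicalPhysics.KineticTheory.hsPressure σ (ρ 0 y) (θ 0 y)) → ∀ t ∈ Set.Ico 0 T, ρ t = ρ 0 ∧ u t = u 0 ∧ θ t = θ 0) → ∀ r ϑ : ℝ, 0 < r → r * σ ^ 3 < η₀ → 0 < ϑ → p r ϑ = Literature.MathematicalPhysics.KineticTheory.hsPressure σ r ϑ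

/-- item stmt-AtomisticToContinuum-13753 · crux · rank 9 · open · by planner
why it might fail: Uniformity: must hold for EVERY σ with ρ_Vσ³<η₀ whatever V's oscillation, but the in-tree canonical cluster expansion (HardSphereEulerLLN.exists_smallDensity) needs 4eMθ/(1−θ) < min β — near-vacuum corners of ρ_V may defeat the inverse activity map; e^{μ_ex} ≤ 2 (a₀ ≤ 2ρ_V∫a₀) needs η₀ small.
sources: Ruelle1969, LebowitzPenrose1964, Spohn1991, PulvirentiTsagkarogiannis2012
[support] (statics: inverse of the local-Gibbs LLN map) ∃ η₀ > 0 ∀ σ > 0, every continuous positive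
normalised (∫ρ_V = 1) profile V = (ρ_V,u_V,θ_V) with ρ_Vσ³ < η₀ is the t = 0 LLN limit of the local
Gibbs laws localGibbsLaw σ a₀ u_V θ_V for some continuous positive activity a₀ with a₀ ≤ 2ρ_V∫a₀ (so
packing guards become activity guards), these laws being probability measures for every N and flow.
Low-density cluster expansion: ρ[a] = a e^(−μ_ex)/C, a contraction for the inverse; strengthens the
proved Literature fact localGibbs_lln_holds by identifying and inverting the limit density.
[difficulty: M] -/
@[route_item "route-AtomisticToContinuum-LoschmidtIsentropicSelection", crux]
def LocalGibbsRealisability : Prop :=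
  ∃ η₀ : ℝ, 0 < η₀ ∧ ∀ σ : ℝ, 0 < σ → ∀ (ρV θV : Literature.MathematicalPhysics.KineticTheory.T3 → ℝ) (uV : Literature.MathematicalPhysics.KineticTheory.T3 → Literature.MathematicalPhysics.KineticTheory.V3), Continuous ρV → Continuous θV → Continuous uV → (∀ x, 0 < ρV x) → (∀ x, 0 < θV x) → (∫ x, ρV x = 1) → (∀ x, ρV x * σ ^ 3 < η₀) → ∃ a₀ : Literature.MathematicalPhysics.KineticTheory.T3 → ℝ, Continuous a₀ ∧ (∀ x, 0 < a₀ x) ∧ (∀ x, a₀ x ≤ 2 * ρV x * ∫ y, a₀ y) ∧ ∀ Φ : (N : ℕ) → Literature.Analysis.FluidPDE.HardSphereFlow (Literature.Analysis.FluidPDE.Torus.geometry (Fin 3)) (Literature.MathematicalPhysics.KineticTheory.hsDiameter σ N) (N + 1), (∀ N, MeasureTheory.IsProbabilityMeasure (Literature.MathematicalPhysics.KineticTheory.localGibbsLaw σ a₀ uV θV N (Φ N))) ∧ Literature.MathematicalPhysics.KineticTheory.TendstoHydroFieldsAt (fun N => Literature.MathematicalPhysics.KineticTheory.localGibbsLaw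 σ a₀ uV θV N (Φ N)) Φ (fun _ => ρV) (fun _ => uV) (fun _ => θV) 0

-- earlier RigidityBridge (stmt-AtomisticToContinuum-13754, replaced 2026-08-16T23:34:21Z -> stmt-AtomisticToContinuum-17759): retired by None — AutonomousClosure → LimitSecondLaw → HydrostaticRung → IsentropicSelection → LocalGibbsRealisability → HsEosLowDensity → HydroLimitInBand
/-- item stmt-AtomisticToContinuum-17759 · crux · rank 9 · open · by planner
why it might fail: Bookkeeping only if typings match: (HYD) needs uniqueness of TendstoHydroFieldsAt limits among continuous profiles under probability laws; (ENT) needs ∫ρ(0)=1 from the LLN (χ≡1) and continuous positive slices; a₀σ³<η_S∫a₀ must follow from a₀≤2ρ∫a₀; a mismatch of the bound IsSol predicates breaks it.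
sources: Spohn1991, Kato1975
[support → to be re-kinded crux] (the route's inner glue, provable now modulo its antecedents;
restated 2026-08-16 WITHOUT the antecedent HsEosLowDensity, which is PROVED in tree —
Theorems.hsEosLowDensity_proof / HsEosLowDensity_holds — and is used inside the proof instead)
AutonomousClosure → LimitSecondLaw → HydrostaticRung → IsentropicSelection → LocalGibbsRealisability
→ HydroLimitInBand (= the re-typed Statement's body). Proof: η₀ := min(η_A, η_S/2, η_H/2, η_R, η_M)
with η_M from hsEosLowDensity_proof (f_ex C^∞ on (0,η_M), 1+2ηF′+η²F″ > 0); given profiles take σ₀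
:= min(η₀^(1/3), σ₀′) with σ₀′ from the PROVED localGibbs_lln_holds (laws are probability measures,
so LLN at 0 with χ ≡ 1 forces ∫ρ(0) = 1); for σ < σ₀ instantiate IsSol, take p̃_σ from
AutonomousClosure, verify (WP), (ENT) from LocalGibbsRealisability + CONV + LimitSecondLaw (activity
guard a₀σ³ ≤ 2ρσ³∫a₀ < η_S∫a₀; slices of smooth solutions are continuous), (HYD) from
LocalGibbsRealisability + HydrostaticRung + CONV + uniqueness of limits in probability (continuous
profiles with equal integrals against all continuous χ coincide); IsentropicSelection gives p̃_σ =
hsPressure σ on the dilute state space, so a guarded -/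
@[route_item "route-AtomisticToContinuum-LoschmidtIsentropicSelection", crux]
def RigidityBridge : Prop :=
  AutonomousClosure → LimitSecondLaw → HydrostaticRung → IsentropicSelection → LocalGibbsRealisability → HydroLimitInBand

/-- item stmt-AtomisticToContinuum-0768 · support · rank 9 · closed · proved by Summit.AtomisticToContinuum.HydrodynamicLimit.Theorems.hsEosLowDensity_proof (prover) · by planner
sources: Ruelle1969, LebowitzPenrose1964
[support] Hard-sphere equation of state at low density: ∃ η₀ > 0 and F real-analytic on (−η₀, η₀)
with hsExcessFreeEnergy = F on [0, η₀), F(0) = 0, F'(0) = 2π/3 (second virial coefficient of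
unit-diameter spheres), and the canonical thermodynamic limit −N⁻¹ log hsFreeVolume η N → F(η)
exists (not just limsup) for η ∈ [0, η₀). Ruelle1969 §3.4 (existence), LebowitzPenrose1964
(convergence of the virial expansion ⇒ analyticity). Makes hsCompressibility/hsPressure smooth and
Z(η) = 1 + (2π/3)η + O(η²); needed by every route (hyperbolicity of the Euler system, virial
theorem). -/
@[route_item "route-AtomisticToContinuum-LoschmidtIsentropicSelection"]
def HsEosLowDensity : Prop :=
  ∃ η₀ : ℝ, 0 < η₀ ∧ ∃ F : ℝ → ℝ, AnalyticOnNhd ℝ F (Set.Ioo (-η₀) η₀) ∧ Set.EqOn Literature.MathematicalPhysics.KineticTheory.hsExcessFreeEnergy F (Set.Ico 0 η₀) ∧ F 0 = 0 ∧ deriv F 0 = 2 * Real.pi / 3 ∧ ∀ η ∈ Set.Ico 0 η₀, Filter.Tendsto (fun N : ℕ => -(N : ℝ)⁻¹ * Real.log (Literature.MathematicalPhysics.KineticTheory.hsFreeVolume η N)) Filter.atTop (nhds (F η))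

/-- `HsEosLowDensity` holds: proved by `Summit.AtomisticToContinuum.HydrodynamicLimit.Theorems.hsEosLowDensity_proof`. -/
theorem HsEosLowDensity_holds : HsEosLowDensity := _root_.Summit.AtomisticToContinuum.HydrodynamicLimit.Theorems.hsEosLowDensity_proof

-- earlier Assembly (stmt-AtomisticToContinuum-13755, replaced 2026-08-16T23:25:15Z -> stmt-AtomisticToContinuum-17648): retired by None — AutonomousClosure → LimitSecondLaw → HydrostaticRung → IsentropicSelection → LocalGibbsRealisability → HsEosLowDensity → RigidityBridge → DiluteSelfConsistency → _root_.HydrodynamicLimit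
-- earlier Assembly (stmt-AtomisticToContinuum-17648, replaced 2026-08-16T23:34:21Z -> stmt-AtomisticToContinuum-17760): retired by None — AutonomousClosure → LimitSecondLaw → HydrostaticRung → IsentropicSelection → LocalGibbsRealisability → HsEosLowDensity → RigidityBridge → _root_.HydrodynamicLimit
/-- item stmt-AtomisticToContinuum-17760 · assembly · rank 1 · open · by planner
sources: Spohn1991, OllaVaradhanYau1993
[assembly] the thesis-to-Statement implication: AutonomousClosure → LimitSecondLaw → HydrostaticRung
→ IsentropicSelection → LocalGibbsRealisability → HydrodynamicLimit (the sub-problem Statement decl,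
by name; the proved EOS input HsEosLowDensity is consumed inside the proof). Since the statement
re-type of 2026-08-16 the Statement's body is verbatim HydroLimitInBand, so this is the content of
RigidityBridge concluded at the root name (either closes the other by one line; `closes` =
RigidityBridge applied to the five other hypotheses). Restated 2026-08-16 from the interim form `… →
RigidityBridge → HydrodynamicLimit`, which the ground battery closes by `aesop` (ground.trivial) —
the frame statement should carry the derivation, not assume it. -/
@[route_item "route-AtomisticToContinuum-LoschmidtIsentropicSelection"]
def Assembly : Prop :=
  AutonomousClosure → LimitSecondLaw → HydrostaticRung → IsentropicSelection → LocalGibbsRealisability → _root_.HydrodynamicLimit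

/-! D-0027 §2.1 — DECIDING THEOREM (planner-authored via `route open/edit --closes-file`; by planner-rrepair-AtomisticToContinuum-Loschmidt-d4d0fbe0-0 2026-08-16T23:38:51Z):
its hypotheses are this route's items and its conclusion the sub-problem Statement (glue_lint), and it elaborates with this file. -/

/-- The deciding theorem (D-0027 §2.1; crux-only, obligation-graph LAYER INVARIANT (ii)): the
route's CRUX items imply the sub-problem statement `_root_.HydrodynamicLimit` by name. Since the
statement re-type of 2026-08-16 (p126922) the sub-problem Statement IS the packing-guarded
conjunct `∃ η₀ > 0, ∀ profiles, ∃ σ₀, ∀ σ < σ₀, ∀ classical hs-Euler solutions with ρσ³ < η₀ on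
[0,T) × 𝕋³, LLN at 0 ⇒ LLN at every t < T` — verbatim the body of this route's target
`HydroLimitInBand` — so the bridge `RigidityBridge`, applied to the three physical cruxes
(`AutonomousClosure`, `LimitSecondLaw`, `HydrostaticRung`), the constitutive-rigidity step
`IsentropicSelection` and the statics step `LocalGibbsRealisability`, concludes it definitionally
(the equation-of-state input `HsEosLowDensity` is PROVED in tree, `HsEosLowDensity_holds`, and is
consumed inside the proof of `RigidityBridge`, not assumed here): the packing guard of the
Statement is exactly the guard under which every item of this route is stated, and no
guard-removal input (formerly `DiluteSelfConsistency`) is needed. -/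
@[closes "route-AtomisticToContinuum-LoschmidtIsentropicSelection"] theorem closes (hA : AutonomousClosure) (hS : LimitSecondLaw) (hH : HydrostaticRung)
    (hI : IsentropicSelection) (hR : LocalGibbsRealisability) (hB : RigidityBridge) :
    _root_.HydrodynamicLimit :=
  hB hA hS hH hI hR

end Summit.AtomisticToContinuum.HydrodynamicLimit.Theses.LoschmidtIsentropicSelection
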